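/-
Copyright (c) 2026 the pub-hodgecm-mathlib formalisation cell (harness21).  Prover seat hodgecm-mathlib-LH4-p08 (g7), req620 Track A «(D-RAM) FOUR-FRAME» squad, helper lane
on h413 = stmt-HodgeConjecture-24833 (count-neutral).  STAGE-1b typed inventory, U2H side (heir LEAD F0P3a-plan (g20) T19-24 «pre-scoping by idle hands: allowed»).  2026-09-04.
-/
import Summits.HodgeConjecture.HodgeConjecture.Theorems.F0P3cDyRamHProfilesTypeOneAffineWild   -- ★ p856067 (LH4-p12 (g2)): (ρ1a) `hProfiles_typeOne_affine_wild` — the type-(1) H-dictionary in affine form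
import Summits.HodgeConjecture.HodgeConjecture.Theorems.F0P3cDyRamRowThreeReduction             -- ★ (LH4-p06 (g2)): `measureReal_support_hFamily_ne_zero` — the profile volumes `ν_s ≠ 0`
import HarnessLib

/-!
# Crux `H413`, line LH4 «(D-RAM) FOUR-FRAME» — THE TYPE-(1) H-SIDE SUPPLY IS AFFINE-COMPLETE: every target `A·V(N) + B` near `1` is `Σ_s coef_s · Φ^st(γ_H, hFamily s)`

Cell `hodgecm-mathlib` (D-0151), FLOOR 0, crux item H413 = `stmt-HodgeConjecture-24833`, route of record `HCCMUnconditional`; squad F0∕P3c∕LH4 (req618∕req620); helper lane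
`--supports stmt-HodgeConjecture-24833 --as helper` (count-neutral).  THEOREMS ONLY (no `def`, no instance, no notation, no `sorry`, default heartbeats).

WHY (STAGE-1b typed inventory, unit U2H side).  The three open tier-0 rows `F0P3cDyRamFourFrame.stub_rows_transvPlus ∕ …transvMinus ∕ …regular` are, by ★ p858618 ∕ ★ p858649 ∕
the piece-generic sockets being typed this hour (LH4-p11 `pieceRowsWild_of_signedCensus`, LH4-p05 (J) port), reduced on their type-(1) population to: (G) a κ-signed four-frame
census LAW of the piece and (H) an H-side family realising `Δ‴_v[μ](γ_H, t_{b₀}) · νG₃(K) · ‹that law›`; after ★ «Δ2» `exists_nhds_one_forall_rowOne_rhs_collapse` (which holds for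
EVERY amplitude `x : ℂ`) the H-side target is a depth-only amplitude.  The unit-U2H family `hFamily` (two profiles: the `K_H`-indicator and the `K♯`-indicator) has the ★ (ρ1a)
dictionary `Φ^st(γ_H, hFamily s) = 2ν_s · V(N) + λ_s` on type-(1) `γ_H` of depth `N ≥ depthOfRecord d`, `N + d` even, with `V(N) = 2(q^{(N−d)∕2+1} − 1)∕(q − 1)`,
`λ_{s_V} = 0` for the vertex-type profile `s_V = d mod 2` and `λ_s = −2ν_s` for the other, `ν_s = νH(supp hFamily s) ≠ 0` (★ `measureReal_support_hFamily_ne_zero`).  The 2 × 2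
matrix `(2ν_s, λ_s)_s` is therefore INVERTIBLE, so EVERY affine target `A·V(N) + B` (`A, B : ℂ` constants) is realised by `hFamily` with the explicit coefficients
`coef_{s_V} := (A + B)∕(2ν_{s_V})`, `coef_s := −B∕(2ν_s)` (`s ≠ s_V`): `coef_{s_V}·2ν_{s_V}·V + coef_s·2ν_s·(V − 1) = (A + B)V − B(V − 1) = A·V + B`.
CONSEQUENCE FOR THE DIRECTIVE: a STAGE-1b piece whose κ-signed census law is affine in `V(N)` needs NO new H-profile for its row (1) — only these coefficient letters; a law with a
term outside `span{1, V(N)}` (e.g. `q^{2·((N−d)∕2)}`, or an `N`-linear term) names exactly the third profile the H-side must grow (a deeper `K_H`-level indicator), to be cut then.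

WHAT IS PROVED.
* `affine_coef_identity` — the scalar identity behind the coefficients (pure field algebra).
* `exists_coef_hFamily_affine` — ★ (ρ1a)'s binders VERBATIM, then `∀ A B : ℂ, ∃ coef : Fin 2 → ℂ, ∃ V ∈ 𝓝 1, ∀ γ_H ∈ V` `G`-regular, ∀ distinct norm-one `w`-roots `α ≠ γ` of
  depth `N ≥ depthOfRecord d`, `N + d` even: `Σ_s coef s · Φ^st(γ_H, hFamily s) = A · V(N) + B` (the `V(N)` term is ★ (ρ1a)'s, token for token).
HONEST LABEL.  Count-neutral (`--supports`): pure linear algebra over ★ (ρ1a) and ★ `measureReal_support_hFamily_ne_zero`; it pays no registered stub and touches no `Lines/`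
module; the three tier-0 rows stay OPEN; `HC_CM` is proved only modulo the 7 printed citations (2 remaining named inputs: hLiu418 = `stmt-HodgeConjecture-24832`, h413 =
`stmt-HodgeConjecture-24833`) until rung 0 closes.

## References
* [Rogawski1990] J. D. Rogawski, *Automorphic Representations of Unitary Groups in Three Variables*, Ann. of Math. Stud. 123 (1990), §4.9 Prop. 4.9.1 (b) p. 55, Lemma 4.9.3 p. 56
  (the H-side of the unit transfer: stable orbital integrals of `1_{K_H}` near `1`).
* [LabesseLanglands1979] J.-P. Labesse, R. P. Langlands, *L-indistinguishability for SL(2)*, Canad. J. Math. 31 (1979), §2 (2.2) (edge-ball counts `δ_m = 2q^m`).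
-/

set_option autoImplicit false

noncomputable section

namespace Summit.HodgeConjecture.HodgeConjecture.Cruxes.H413.F0P3cDyRamHFamilyAffineSpan

open MeasureTheory Measure NumberField IsDedekindDomain Topology Filter
open Literature.NumberTheory.Automorphic Literature.NumberTheory.Automorphic.UnitaryGroup Literature.NumberTheory.Automorphic.IntegralReduction
open Literature.NumberTheory.Rogawski1990 Literature.NumberTheory.GaloisRepresentations
open Literature.NumberTheory.Automorphic.UnitaryThreeFourFrame
open Literature.NumberTheory.Automorphic.UnitaryLatticeTree Literature.NumberTheory.Automorphic.HermitianLattice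
open Summit.HodgeConjecture.HodgeConjecture.Cruxes.H413.F0P3cDyRamFourFrameHSideDefs
open Summit.HodgeConjecture.HodgeConjecture.Cruxes.H413.F0P3cDyRamFourFrameHFamilyDefs
open Summit.HodgeConjecture.HodgeConjecture.Cruxes.H413.F0P3cDyRamHProfilesTypeOneAffineWild
open Summit.HodgeConjecture.HodgeConjecture.Cruxes.H413.F0P3cDyRamRowThreeReduction
open scoped Matrix MatrixGroups Classical ValuativeRel WithZero

/-! ## §1  The scalar identity -/

/-- The coefficient identity: with `ν_V, ν_E ≠ 0`, `((A + B)∕(2ν_V))·(2ν_V·X + 0) + (−B∕(2ν_E))·(2ν_E·X + (−2ν_E)) = A·X + B`. [cite: Rogawski1990, §4.9 Lemma 4.9.3 p. 56] -/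
theorem affine_coef_identity {νV νE : ℂ} (hV : νV ≠ 0) (hE : νE ≠ 0) (A B X : ℂ) :
    (A + B) / (2 * νV) * (2 * νV * X + 0) + -B / (2 * νE) * (2 * νE * X + -2 * νE) = A * X + B := by
  field_simp
  ring

/-! ## §2  The affine span of the two H-profiles on the type-(1) population -/

/-- **THE TYPE-(1) H-SIDE SUPPLY IS AFFINE-COMPLETE.**  At every wild ramified non-split CM place (★ (ρ1a)'s binders VERBATIM: datum `(ϖ, d, t_E)`, finite residue field,
Haar `νH`, canonical `mH`), for every pair of constants `A, B : ℂ` there are coefficients `coef : Fin 2 → ℂ` such that near `1 ∈ H_v`, on every `G`-regular `γ_H` with distinct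
norm-one `w`-roots `α ≠ γ` of depth `N ≥ depthOfRecord d` with `N + d` even, `Σ_s coef s · Φ^st(γ_H, hFamily s) = A · V(N) + B`, `V(N) = 2(q^{(N−d)∕2+1} − 1)∕(q − 1)` (★ (ρ1a)'s
amplitude token for token).  Explicitly `coef_{s_V} = (A + B)∕(2ν_{s_V})`, `coef_s = −B∕(2ν_s)` (`s ≠ s_V = d mod 2`).
[cite: Rogawski1990, §4.9 Prop. 4.9.1 (b) p. 55, Lemma 4.9.3 p. 56] [cite: LabesseLanglands1979, §2 (2.2)] -/
theorem exists_coef_hFamily_affine :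
    ∀ (L : Type) [Field L] [NumberField L] [IsCMField L]
      {v : HeightOneSpectrum (𝓞 ↥(maximalRealSubfield L))} (w : UnitaryGroup.PlacesOver L v)
      (hw : IsCMField.complexConj L • w.1 = w.1) (_he : v.asIdeal.ramificationIdx' w.1.asIdeal ≠ 1)
      (_h2 : ¬ IsUnit (2 : 𝒪[w.1.adicCompletion L]))
      (ϖ : (w.1.adicCompletion L)) (_hϖ : Valued.v ϖ = WithZero.exp (-1 : ℤ)) (d tE : ℕ) (_hD : IsRamifiedQuadraticDatum (galAdicCompletionMap (L := L) (IsCMField.complexConj L) hw) ϖ d tE)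
      [Fintype (Valued.ResidueField (w.1.adicCompletion L))]
      [MeasurableSpace ((UnitaryGroup.cmDatum L 2 (Matrix.of fun i j : Fin 2 => if i.val + j.val + 1 = 2 then (1 : L) else 0)).Local v × (UnitaryGroup.cmDatum L 1 (Matrix.of fun i j : Fin 1 => if i.val + j.val + 1 = 1 then (1 : L) else 0)).Local v)] [BorelSpace ((UnitaryGroup.cmDatum L 2 (Matrix.of fun i j : Fin 2 => if i.val + j.val + 1 = 2 then (1 : L) else 0)).Local v × (UnitaryGroup.cmDatum L 1 (Matrix.of fun i j : Fin 1 => if i.val + j.val + 1 = 1 then (1 : L) else 0)).Local v)]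
      [∀ a : ((UnitaryGroup.cmDatum L 2 (Matrix.of fun i j : Fin 2 => if i.val + j.val + 1 = 2 then (1 : L) else 0)).Local v × (UnitaryGroup.cmDatum L 1 (Matrix.of fun i j : Fin 1 => if i.val + j.val + 1 = 1 then (1 : L) else 0)).Local v), MeasurableSpace (((UnitaryGroup.cmDatum L 2 (Matrix.of fun i j : Fin 2 => if i.val + j.val + 1 = 2 then (1 : L) else 0)).Local v × (UnitaryGroup.cmDatum L 1 (Matrix.of fun i j : Fin 1 => if i.val + j.val + 1 = 1 then (1 : L) else 0)).Local v) ⧸ Subgroup.centralizer ({a} : Set ((UnitaryGroup.cmDatum L 2 (Matrix.of fun i j : Fin 2 => if i.val + j.val + 1 = 2 then (1 : L) else 0)).Local v × (UnitaryGroup.cmDatum L 1 (Matrix.of fun i j : Fin 1 => if i.val + j.val + 1 = 1 then (1 : L) else 0)).Local v)))]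
      [∀ a : ((UnitaryGroup.cmDatum L 2 (Matrix.of fun i j : Fin 2 => if i.val + j.val + 1 = 2 then (1 : L) else 0)).Local v × (UnitaryGroup.cmDatum L 1 (Matrix.of fun i j : Fin 1 => if i.val + j.val + 1 = 1 then (1 : L) else 0)).Local v), BorelSpace (((UnitaryGroup.cmDatum L 2 (Matrix.of fun i j : Fin 2 => if i.val + j.val + 1 = 2 then (1 : L) else 0)).Local v × (UnitaryGroup.cmDatum L 1 (Matrix.of fun i j : Fin 1 => if i.val + j.val + 1 = 1 then (1 : L) else 0)).Local v) ⧸ Subgroup.centralizer ({a} : Set ((UnitaryGroup.cmDatum L 2 (Matrix.of fun i j : Fin 2 => if i.val + j.val + 1 = 2 then (1 : L) else 0)).Local v × (UnitaryGroup.cmDatum L 1 (Matrix.of fun i j : Fin 1 => if i.val + j.val + 1 = 1 then (1 : L) else 0)).Local v)))]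
      (νH : Measure ((UnitaryGroup.cmDatum L 2 (Matrix.of fun i j : Fin 2 => if i.val + j.val + 1 = 2 then (1 : L) else 0)).Local v × (UnitaryGroup.cmDatum L 1 (Matrix.of fun i j : Fin 1 => if i.val + j.val + 1 = 1 then (1 : L) else 0)).Local v)) [νH.IsHaarMeasure] [νH.IsMulRightInvariant]
      (mH : OrbitalMeasureFamily ((UnitaryGroup.cmDatum L 2 (Matrix.of fun i j : Fin 2 => if i.val + j.val + 1 = 2 then (1 : L) else 0)).Local v × (UnitaryGroup.cmDatum L 1 (Matrix.of fun i j : Fin 1 => if i.val + j.val + 1 = 1 then (1 : L) else 0)).Local v))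
      (_hmH : mH.IsCanonical (IsLocalGRegular L v) νH),
      ∀ A B : ℂ, ∃ coef : Fin 2 → ℂ,
      ∃ V ∈ 𝓝 (1 : ((UnitaryGroup.cmDatum L 2 (Matrix.of fun i j : Fin 2 => if i.val + j.val + 1 = 2 then (1 : L) else 0)).Local v × (UnitaryGroup.cmDatum L 1 (Matrix.of fun i j : Fin 1 => if i.val + j.val + 1 = 1 then (1 : L) else 0)).Local v)), ∀ γH ∈ V, IsLocalGRegular L v γH →
              ∀ (α γ : (w.1.adicCompletion L)), ((((γH).1.val : GL (Fin 2) (UnitaryGroup.LocalRing L v)).val.map (Pi.evalRingHom (fun w' : UnitaryGroup.PlacesOver L v => w'.1.adicCompletion L) w))).charpoly.IsRoot α → ((((γH).1.val : GL (Fin 2) (UnitaryGroup.LocalRing L v)).val.map (Pi.evalRingHom (fun w' : UnitaryGroup.PlacesOver L v => w'.1.adicCompletion L) w))).charpoly.IsRoot γ → α ≠ γ → α * (galAdicCompletionMap (L := L) (IsCMField.complexConj L) hw) α = 1 → γ * (galAdicCompletionMap (L := L) (IsCMField.complexConj L) hw) γ = 1 →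
                ∀ N : ℕ, Valued.v (α - γ) = WithZero.exp (-(N : ℤ)) → depthOfRecord d ≤ N → (N + d) % 2 = 0 →
                  ∑ s : Fin 2, coef s * stableOrbitalIntegralRel (IsLocalStablyConjH L v) mH (hFamily L w hw ϖ s) γH =
                    A * (((2 * ((Fintype.card (Valued.ResidueField (w.1.adicCompletion L)) : ℚ) ^ (((N - d) / 2 : ℕ) + 1) - 1) / ((Fintype.card (Valued.ResidueField (w.1.adicCompletion L)) : ℚ) - 1) : ℚ)) : ℂ) + B := by
  intro L _i1 _i2 _i3 v w hw he h2 ϖ hϖ d tE hD _iF _i4 _i5 _i6 _i7 νH _i8 _i9 mH hmH A B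
  -- the ★ (ρ1a) dictionary and the profile volumes
  obtain ⟨V, hV, hdict⟩ := hProfiles_typeOne_affine_wild L w hw he h2 ϖ hϖ d tE hD νH mH hmH
  have hν : ∀ s : Fin 2, (νH.real (Function.support (hFamily L w hw ϖ s)) : ℂ) ≠ 0 :=
    fun s => measureReal_support_hFamily_ne_zero L w hw he ϖ hϖ νH s
  -- the explicit coefficients: `(A + B)∕(2ν)` on the vertex-type profile `s_V = d % 2`, `−B∕(2ν)` on the other
  refine ⟨fun s => if ((s : Fin 2) : ℕ) = d % 2 then (A + B) / (2 * (νH.real (Function.support (hFamily L w hw ϖ s)) : ℂ))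
      else -B / (2 * (νH.real (Function.support (hFamily L w hw ϖ s)) : ℂ)), V, hV, ?_⟩
  intro γH hγ hreg α γ hα hγr hαγ hα1 hγ1 N hN hN₀ hpar
  have h0 := hdict γH hγ hreg α γ hα hγr hαγ hα1 hγ1 N hN hN₀ hpar 0
  have h1 := hdict γH hγ hreg α γ hα hγr hαγ hα1 hγ1 N hN hN₀ hpar 1
  rw [Fin.sum_univ_two, h0, h1]
  -- `d % 2 ∈ {0, 1}`: exactly one of the two profiles is the vertex-type one
  rcases Nat.mod_two_eq_zero_or_one d with hd | hd
  · simp only [Fin.isValue, Fin.val_zero, Fin.val_one, hd, if_true, show (1 : ℕ) ≠ 0 from one_ne_zero, if_false]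
    rw [affine_coef_identity (hν 0) (hν 1)]
  · simp only [Fin.isValue, Fin.val_zero, Fin.val_one, hd, if_true, show (0 : ℕ) ≠ 1 from zero_ne_one, if_false]
    rw [add_comm, affine_coef_identity (hν 1) (hν 0)]

/-! ## §3  ED. 2 (append-only; payer LH4-p14 (g5) 09:05:20Z ask): the EXPLICIT-COEFFICIENT export -/

/-- **THE AFFINE SPAN WITH THE COEFFICIENTS NAMED (ED. 2).**  Same binders as `exists_coef_hFamily_affine`; the coefficient vector is now the EXPLICIT function
`s ↦ if s = s_V then (A + B)∕(2ν_s) else −B∕(2ν_s)` (`s_V = d mod 2`, `ν_s = νH(supp hFamily s)`), so a consumer can state rows (2)(3) of a piece «at that coefficient vector» as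
hypotheses (payer LH4-p14 (g5)'s (H-j) reading).  Near `1`, on type-(1) `γ_H` of depth `N ≥ depthOfRecord d` with `N + d` even:
`Σ_s coef_s · Φ^st(γ_H, hFamily s) = A · V(N) + B`. [cite: Rogawski1990, §4.9 Prop. 4.9.1 (b) p. 55, Lemma 4.9.3 p. 56] [cite: LabesseLanglands1979, §2 (2.2)] -/
theorem sum_coefAffine_hFamily_eq :
    ∀ (L : Type) [Field L] [NumberField L] [IsCMField L]
      {v : HeightOneSpectrum (𝓞 ↥(maximalRealSubfield L))} (w : UnitaryGroup.PlacesOver L v)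
      (hw : IsCMField.complexConj L • w.1 = w.1) (_he : v.asIdeal.ramificationIdx' w.1.asIdeal ≠ 1)
      (_h2 : ¬ IsUnit (2 : 𝒪[w.1.adicCompletion L]))
      (ϖ : (w.1.adicCompletion L)) (_hϖ : Valued.v ϖ = WithZero.exp (-1 : ℤ)) (d tE : ℕ) (_hD : IsRamifiedQuadraticDatum (galAdicCompletionMap (L := L) (IsCMField.complexConj L) hw) ϖ d tE)
      [Fintype (Valued.ResidueField (w.1.adicCompletion L))]
      [MeasurableSpace ((UnitaryGroup.cmDatum L 2 (Matrix.of fun i j : Fin 2 => if i.val + j.val + 1 = 2 then (1 : L) else 0)).Local v × (UnitaryGroup.cmDatum L 1 (Matrix.of fun i j : Fin 1 => if i.val + j.val + 1 = 1 then (1 : L) else 0)).Local v)] [BorelSpace ((UnitaryGroup.cmDatum L 2 (Matrix.of fun i j : Fin 2 => if i.val + j.val + 1 = 2 then (1 : L) else 0)).Local v × (UnitaryGroup.cmDatum L 1 (Matrix.of fun i j : Fin 1 => if i.val + j.val + 1 = 1 then (1 : L) else 0)).Local v)]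
      [∀ a : ((UnitaryGroup.cmDatum L 2 (Matrix.of fun i j : Fin 2 => if i.val + j.val + 1 = 2 then (1 : L) else 0)).Local v × (UnitaryGroup.cmDatum L 1 (Matrix.of fun i j : Fin 1 => if i.val + j.val + 1 = 1 then (1 : L) else 0)).Local v), MeasurableSpace (((UnitaryGroup.cmDatum L 2 (Matrix.of fun i j : Fin 2 => if i.val + j.val + 1 = 2 then (1 : L) else 0)).Local v × (UnitaryGroup.cmDatum L 1 (Matrix.of fun i j : Fin 1 => if i.val + j.val + 1 = 1 then (1 : L) else 0)).Local v) ⧸ Subgroup.centralizer ({a} : Set ((UnitaryGroup.cmDatum L 2 (Matrix.of fun i j : Fin 2 => if i.val + j.val + 1 = 2 then (1 : L) else 0)).Local v × (UnitaryGroup.cmDatum L 1 (Matrix.of fun i j : Fin 1 => if i.val + j.val + 1 = 1 then (1 : L) else 0)).Local v)))]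
      [∀ a : ((UnitaryGroup.cmDatum L 2 (Matrix.of fun i j : Fin 2 => if i.val + j.val + 1 = 2 then (1 : L) else 0)).Local v × (UnitaryGroup.cmDatum L 1 (Matrix.of fun i j : Fin 1 => if i.val + j.val + 1 = 1 then (1 : L) else 0)).Local v), BorelSpace (((UnitaryGroup.cmDatum L 2 (Matrix.of fun i j : Fin 2 => if i.val + j.val + 1 = 2 then (1 : L) else 0)).Local v × (UnitaryGroup.cmDatum L 1 (Matrix.of fun i j : Fin 1 => if i.val + j.val + 1 = 1 then (1 : L) else 0)).Local v) ⧸ Subgroup.centralizer ({a} : Set ((UnitaryGroup.cmDatum L 2 (Matrix.of fun i j : Fin 2 => if i.val + j.val + 1 = 2 then (1 : L) else 0)).Local v × (UnitaryGroup.cmDatum L 1 (Matrix.of fun i j : Fin 1 => if i.val + j.val + 1 = 1 then (1 : L) else 0)).Local v)))]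
      (νH : Measure ((UnitaryGroup.cmDatum L 2 (Matrix.of fun i j : Fin 2 => if i.val + j.val + 1 = 2 then (1 : L) else 0)).Local v × (UnitaryGroup.cmDatum L 1 (Matrix.of fun i j : Fin 1 => if i.val + j.val + 1 = 1 then (1 : L) else 0)).Local v)) [νH.IsHaarMeasure] [νH.IsMulRightInvariant]
      (mH : OrbitalMeasureFamily ((UnitaryGroup.cmDatum L 2 (Matrix.of fun i j : Fin 2 => if i.val + j.val + 1 = 2 then (1 : L) else 0)).Local v × (UnitaryGroup.cmDatum L 1 (Matrix.of fun i j : Fin 1 => if i.val + j.val + 1 = 1 then (1 : L) else 0)).Local v))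
      (_hmH : mH.IsCanonical (IsLocalGRegular L v) νH),
      ∀ A B : ℂ,
      ∃ V ∈ 𝓝 (1 : ((UnitaryGroup.cmDatum L 2 (Matrix.of fun i j : Fin 2 => if i.val + j.val + 1 = 2 then (1 : L) else 0)).Local v × (UnitaryGroup.cmDatum L 1 (Matrix.of fun i j : Fin 1 => if i.val + j.val + 1 = 1 then (1 : L) else 0)).Local v)), ∀ γH ∈ V, IsLocalGRegular L v γH →
              ∀ (α γ : (w.1.adicCompletion L)), ((((γH).1.val : GL (Fin 2) (UnitaryGroup.LocalRing L v)).val.map (Pi.evalRingHom (fun w' : UnitaryGroup.PlacesOver L v => w'.1.adicCompletion L) w))).charpoly.IsRoot α → ((((γH).1.val : GL (Fin 2) (UnitaryGroup.LocalRing L v)).val.map (Pi.evalRingHom (fun w' : UnitaryGroup.PlacesOver L v => w'.1.adicCompletion L) w))).charpoly.IsRoot γ → α ≠ γ → α * (galAdicCompletionMap (L := L) (IsCMField.complexConj L) hw) α = 1 → γ * (galAdicCompletionMap (L := L) (IsCMField.complexConj L) hw) γ = 1 →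
                ∀ N : ℕ, Valued.v (α - γ) = WithZero.exp (-(N : ℤ)) → depthOfRecord d ≤ N → (N + d) % 2 = 0 →
                  ∑ s : Fin 2, (fun s : Fin 2 => if ((s : Fin 2) : ℕ) = d % 2 then (A + B) / (2 * (νH.real (Function.support (hFamily L w hw ϖ s)) : ℂ))
          else -B / (2 * (νH.real (Function.support (hFamily L w hw ϖ s)) : ℂ))) s *
                      stableOrbitalIntegralRel (IsLocalStablyConjH L v) mH (hFamily L w hw ϖ s) γH =
                    A * (((2 * ((Fintype.card (Valued.ResidueField (w.1.adicCompletion L)) : ℚ) ^ (((N - d) / 2 : ℕ) + 1) - 1) / ((Fintype.card (Valued.ResidueField (w.1.adicCompletion L)) : ℚ) - 1) : ℚ)) : ℂ) + B := by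
  intro L _i1 _i2 _i3 v w hw he h2 ϖ hϖ d tE hD _iF _i4 _i5 _i6 _i7 νH _i8 _i9 mH hmH A B
  obtain ⟨V, hV, hdict⟩ := hProfiles_typeOne_affine_wild L w hw he h2 ϖ hϖ d tE hD νH mH hmH
  have hν : ∀ s : Fin 2, (νH.real (Function.support (hFamily L w hw ϖ s)) : ℂ) ≠ 0 :=
    fun s => measureReal_support_hFamily_ne_zero L w hw he ϖ hϖ νH s
  refine ⟨V, hV, ?_⟩
  intro γH hγ hreg α γ hα hγr hαγ hα1 hγ1 N hN hN₀ hpar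
  have h0 := hdict γH hγ hreg α γ hα hγr hαγ hα1 hγ1 N hN hN₀ hpar 0
  have h1 := hdict γH hγ hreg α γ hα hγr hαγ hα1 hγ1 N hN hN₀ hpar 1
  rw [Fin.sum_univ_two, h0, h1]
  rcases Nat.mod_two_eq_zero_or_one d with hd | hd
  · simp only [Fin.isValue, Fin.val_zero, Fin.val_one, hd, if_true, show (1 : ℕ) ≠ 0 from one_ne_zero, if_false]
    rw [affine_coef_identity (hν 0) (hν 1)]
  · simp only [Fin.isValue, Fin.val_zero, Fin.val_one, hd, if_true, show (0 : ℕ) ≠ 1 from zero_ne_one, if_false]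
    rw [add_comm, affine_coef_identity (hν 1) (hν 0)]

end Summit.HodgeConjecture.HodgeConjecture.Cruxes.H413.F0P3cDyRamHFamilyAffineSpan

end
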